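import Summits.CriticalPhenomena.PercolationContinuityZ3.Theorems.Transplant.SkelKitResidues
import Summits.CriticalPhenomena.PercolationContinuityZ3.Theorems.Transplant.SkelHabLevels
import HarnessLib

/-!
# L6.0c′ — the CORRIDOR residue of the generic (D) node in PACKAGING-AGNOSTIC, HABITAT form: `Skel.ReachOblAtH` / `Skel.ReachOblRH` (a linked
# chain of ANY length `n ≤ nmaxC` of target steps in ANY habitat-restricted window graph `Skel.winGraphIn G Ω` — exactly the hypotheses of the
# generic core `KSchA.hreach_of_chain_edge_sub` minus the chain property and `δc ≤ δ`), and **`Skel.kitAtRun_of_oblRH`** — superseding the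
# plain-window (C) clauses `Skel.ReachOblAt/ReachOblR` of `SkelKitResidues` (p234400), which are UNINHABITABLE for `Skel.cellGeomSG`
# (p2-g4's obstruction, SHEAR-SCOPE §2.6: `rQ ≤ Rπ ≤ ρ(5r) ≤ rQ − 1`); the root and face residues `Skel.RootOblT` / `Skel.FaceOblR` are unchanged

builds on p205010 (kernel theorem, internal audit signed; external expert review pending) — nothing in this file uses p205010.
Status sentence (coordinator 2026-08-20T04:30Z): "θ(p_c) = 0 on ℤ^d, all d ≥ 2 — kernel-verified (Lean 4/Mathlib, standard axioms); internal adversarial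
audit SIGNED 2026-08-20 04:29Z; external expert review pending."
Lane `prim-bschramm-*`, seat `prim-bschramm-stmt` (gen 7; lead 20:06:28Z: Ω-twins of the (C) clauses by stmt; p2-g4's `SkelHabLevels` p235203 =
`Skel.winGraphIn G Ω`).  Helper file (`--supports stmt-CriticalPhenomena-4575`).
WHY PACKAGING-AGNOSTIC: the (C) packaging over a skeleton is still being designed (habitat `Ω := B(root, Rπ) ∩ Ucor`, the seam `Q | Hfull` —
p2-g4 20:05:20Z, p5-g4 20:16:19Z); the node-facing residue therefore asks only for what the generic core consumes — a linked chain `s` of `n + 1`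
target steps (`n ≤ nmaxC = 1000`, so that ONE chain accuracy serves every length) in some `winGraphIn G Ω`, common source the root, kits at
accuracy `δ` under the corridor law `S.Wcor`, true targets with excess `≤ η ≤ δ/2`, the arrival cube `M^{α}_x ⊆ X^{(0)}_0` and the last true
target inside `M^{a'}_{x+du}` — and the (C) seat builds `s` with whatever habitat packaging survives the rulings (`HabChainData.kitsAt_…`).
* `Skel.nmaxC := 1000`; `Skel.ReachOblAtH G S FD Δ' δ h e a' du`, `Skel.ReachOblRH G S FD Δ' δ` (run histories, chosen edge, onward `du`, at `aOf₂`);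
* `reach_of_reachOblAtH` (one line over the core); **`Skel.kitAtRun_of_oblRH`** — `δc ≤ δ`, `hstep` (window graphs `winGraph G c Rπ`, as for
  `FaceOblR`), `hchainH : ∀ n ≤ nmaxC, ∀ Ω, …` at `(δ ↦ ε'')`, `hchainr` (as for `RootOblT`), `RootOblT`, `FaceOblR`, `ReachOblRH` ⟹ `KitAtRun G S FD δ₂ ε''`.
[cite: KozmaNitzan2024, §4 (30), (32) (pp. 27–28), Lemma 10 (p. 17), Lemmas 11–12 (pp. 22–25), p. 30 (Steps III–IV)]
-/

noncomputable section

open MeasureTheory ProbabilityTheory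
open scoped ENNReal Classical

namespace Summit.CriticalPhenomena.PercolationContinuityZ3.Theorems

namespace Transplant

namespace Skel

open Literature.Probability.Percolation Literature.Probability.LatticeModels SimpleGraph KNCells
open GadgetSystem ProbeHistory HSiteScheme Contour

variable {V : Type} [DecidableEq V] [Countable V] {G : SimpleGraph V} [G.LocallyFinite] (Φ : PlanarSkeletonConc G)
variable {A : Type*}

/-! ## §1 The corridor residue, habitat form -/

omit Φ in
/-- **The maximal corridor-chain length served by one chain accuracy** (`1000`; the planar schedule `ChainPlanar.Sched` has `nLast + 1 = 88`
steps, any re-packaging across the cube / corridor seam stays far below). [this work] -/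
def nmaxC : ℕ := 1000

omit Φ in
/-- `ChainPlanar.Sched.nLast ≤ nmaxC`. [folklore] -/
theorem nLast_le_nmaxC : ChainPlanar.Sched.nLast ≤ nmaxC := by
  unfold nmaxC ChainPlanar.Sched.nLast; omega

variable (G) in
/-- **The corridor obligation at one probe `(h, e, a', du)`, habitat form**: for some length `n ≤ nmaxC` and some finite habitat `Ω`, a linked
chain of `n + 1` target steps in `winGraphIn G Ω` with common source the scheme's root, kits at accuracy `δ` under the corridor law `S.Wcor`,
true targets inside the enlarged ones with excess `≤ η ≤ δ/2`, the arrival cube `M^{aOf₁}_{tgt e}` inside the first level and the last true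
target inside `M^{a'}_{tgt e + du}` — the hypotheses of `KSchA.hreach_of_chain_edge_sub` except the chain property and `δc ≤ δ`.
[cite: KozmaNitzan2024, §4 Lemma 12 (pp. 23–25), p. 30 (Step IV)] -/
def ReachOblAtH (S : KSchA V A) (FD : FaceData V A) (Δ' : ℕ) (δ : ℝ) (h : ProbeHistory V) (e : Site 2 × MDir) (a' : A) (du : MDir) : Prop :=
  ∃ (n : ℕ) (_ : n ≤ nmaxC) (Ω : Finset V) (s : Fin (n + 1) → KNLevels.TStep (winGraphIn G Ω)) (T' : Fin (n + 1) → Finset V) (η : ℝ),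
    (∀ i : Fin (n + 1), (s i).L.o = S.Γ.root) ∧
    (∀ i : Fin n, T' (Fin.castSucc i) ⊆ (s i.succ).L.X 0) ∧ (∀ i : Fin (n + 1), T' i ⊆ (s i).T) ∧
    (∀ i : Fin (n + 1), (s i).KitsAt (S.Wcor G FD h e (S.aOf₁ G h e) a' du) S.p Δ' δ) ∧ η ≤ δ / 2 ∧
    (∀ i : Fin (n + 1), (prodBernoulli (S.Wcor G FD h e (S.aOf₁ G h e) a' du)).real (⋃ t ∈ (s i).T \ T' i, openConn S.Γ.root t) ≤ η) ∧
    S.Γ.M (S.aOf₁ G h e) (tgt e) ⊆ (s 0).L.X 0 ∧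
    T' (Fin.last n) ⊆ S.Γ.M a' (tgt e + stepVec du)

variable (G) in
/-- **The corridor obligations, run-restricted habitat form**: `ReachOblAtH` for every RUN history whose chosen candidate is `e`, valid, and every
onward direction, at `a' = aOf₂`.  THE node-facing (C) residue. [cite: KozmaNitzan2024, §4 p. 30 (Step IV), Lemma 12 (pp. 23–25)] -/
def ReachOblRH (S : KSchA V A) (FD : FaceData V A) (Δ' : ℕ) (δ : ℝ) : Prop :=
  ∀ h e, S.IsRun₂ G h → (S.astOf₂ G h).st.choice = some e → S.Valid₂ G h e →
    ∀ du ∈ S.onward G h (tgt e), ReachOblAtH G S FD Δ' δ h e (S.aOf₂ G h e) du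

/-! ## §2 Discharging `KitAtRun` from the residues (habitat form) -/

variable {Φ}
variable {S : KSchA V A} {FD : FaceData V A}
variable {h : ProbeHistory V} {e : Site 2 × MDir} {a' : A} {du : MDir}

omit Φ in
/-- **`ReachOblAtH` + the chain properties of every length `n ≤ nmaxC` at `(δ ↦ ε'')` in every habitat window graph + `δc ≤ δ` ⟹ the corridor
bound `1 - ε'' < P_{Wfull}(Reach)`** (`KSchA.hreach_of_chain_edge_sub`). [cite: KozmaNitzan2024, §4 Lemma 12 (pp. 23–25), p. 30 (Step IV)] -/
theorem reach_of_reachOblAtH (hV : S.Valid₂ G h e) {Δ' : ℕ} {δ ε'' : ℝ} (hδc : S.δc ≤ δ)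
    (hchain : ∀ n ≤ nmaxC, ∀ (Ω : Finset V) (Wg : Sym2 V → unitInterval) (s : Fin (n + 1) → KNLevels.TStep (winGraphIn G Ω))
      (T' : Fin (n + 1) → Finset V) (η : ℝ),
      (∀ i : Fin (n + 1), (s i).L.o = (s 0).L.o) →
      (∀ i : Fin n, T' (Fin.castSucc i) ⊆ (s i.succ).L.X 0) →
      (∀ i : Fin (n + 1), T' i ⊆ (s i).T) →
      (∀ i : Fin (n + 1), (s i).KitsAt Wg S.p Δ' δ) →
      η ≤ δ / 2 →
      (∀ i : Fin (n + 1), (prodBernoulli Wg).real (⋃ t ∈ (s i).T \ T' i, openConn (s 0).L.o t) ≤ η) →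
      1 - δ < (prodBernoulli Wg).real (s 0).L.reachB →
        1 - ε'' < (prodBernoulli Wg).real (⋃ t ∈ T' (Fin.last n), openConn (s 0).L.o t))
    (hR : ReachOblAtH G S FD Δ' δ h e a' du) :
    1 - ε'' < (prodBernoulli (S.Wfull G h e (S.aOf₁ G h e) a' du)).real (S.Reach G FD h e (S.aOf₁ G h e) a' du) := by
  obtain ⟨n, hn, Ω, s, T', η, ho, hlink, hsub, hkits, hη, hexc, hB0, hTn⟩ := hR
  exact KSchA.hreach_of_chain_edge_sub (winGraphIn G Ω) hV hδc (hchain n hn Ω) s T' ho hlink hsub hkits hη hexc hB0 hTn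

/-- **The run-restricted obligations from the named residues, habitat form**: `δc ≤ δ`, the one-step property at `(δ₂ ↦ δc/2)` for the window
graphs, the chain properties of every length `n ≤ nmaxC` at `(δ ↦ ε'')` for the habitat window graphs, the chain properties of every length at
`(δr n ↦ δc)` for the window graphs, `RootOblT … δr`, `FaceOblR … δ₂` and `ReachOblRH … δ` ⟹ p5-g3's `KitAtRun G S FD δ₂ ε''`.
[cite: KozmaNitzan2024, §4 (30), (32), Lemmas 10–12] -/
theorem kitAtRun_of_oblRH {Δ' : ℕ} {δ δ₂ ε'' : ℝ} {δr : ℕ → ℝ} (hδc : S.δc ≤ δ)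
    (hstep : ∀ (c : V) (Rπ : ℕ) (Wg : Sym2 V → unitInterval) (s : KNLevels.TStep (winGraph G c Rπ)), s.KitsAt Wg S.p Δ' δ₂ →
      1 - δ₂ < (prodBernoulli Wg).real s.L.reachB → 1 - S.δc / 2 < (prodBernoulli Wg).real (⋃ t ∈ s.T, openConn s.L.o t))
    (hchain : ∀ n ≤ nmaxC, ∀ (Ω : Finset V) (Wg : Sym2 V → unitInterval) (s : Fin (n + 1) → KNLevels.TStep (winGraphIn G Ω))
      (T' : Fin (n + 1) → Finset V) (η : ℝ),
      (∀ i : Fin (n + 1), (s i).L.o = (s 0).L.o) →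
      (∀ i : Fin n, T' (Fin.castSucc i) ⊆ (s i.succ).L.X 0) →
      (∀ i : Fin (n + 1), T' i ⊆ (s i).T) →
      (∀ i : Fin (n + 1), (s i).KitsAt Wg S.p Δ' δ) →
      η ≤ δ / 2 →
      (∀ i : Fin (n + 1), (prodBernoulli Wg).real (⋃ t ∈ (s i).T \ T' i, openConn (s 0).L.o t) ≤ η) →
      1 - δ < (prodBernoulli Wg).real (s 0).L.reachB →
        1 - ε'' < (prodBernoulli Wg).real (⋃ t ∈ T' (Fin.last n), openConn (s 0).L.o t))
    (hchainr : ∀ (n : ℕ) (c : V) (Rπ : ℕ) (Wg : Sym2 V → unitInterval) (s : Fin (n + 1) → KNLevels.TStep (winGraph G c Rπ))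
      (T' : Fin (n + 1) → Finset V) (η : ℝ),
      (∀ i : Fin (n + 1), (s i).L.o = (s 0).L.o) →
      (∀ i : Fin n, T' (Fin.castSucc i) ⊆ (s i.succ).L.X 0) →
      (∀ i : Fin (n + 1), T' i ⊆ (s i).T) →
      (∀ i : Fin (n + 1), (s i).KitsAt Wg S.p Δ' (δr n)) →
      η ≤ δr n / 2 →
      (∀ i : Fin (n + 1), (prodBernoulli Wg).real (⋃ t ∈ (s i).T \ T' i, openConn (s 0).L.o t) ≤ η) →
      1 - δr n < (prodBernoulli Wg).real (s 0).L.reachB →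
        1 - S.δc < (prodBernoulli Wg).real (⋃ t ∈ T' (Fin.last n), openConn (s 0).L.o t))
    (hQ0 : RootOblT G S Δ' δr) (hface : FaceOblR Φ S FD Δ' δ₂) (hreach : ReachOblRH G S FD Δ' δ) :
    KSchA.KitAtRun G S FD δ₂ ε'' := by
  refine And.intro (rootObl_of_rootOblT hchainr hQ0) (And.intro ?_ ?_)
  · intro h e hrun hc hV du hdu j hj o hsrc
    exact cond_of_faceOblAt hstep (hface h e hrun hc hV du hdu j hj o) hsrc
  · intro h e hrun hc hV du hdu
    exact reach_of_reachOblAtH hV hδc hchain (hreach h e hrun hc hV du hdu)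

end Skel

end Transplant

end Summit.CriticalPhenomena.PercolationContinuityZ3.Theorems

end
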